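import Mathlib.Combinatorics.Configuration
import Mathlib.LinearAlgebra.Projectivization.Cardinality
import Mathlib.Algebra.Field.ZMod
import Mathlib.Logic.Equiv.Fin.Basic
import Mathlib.Data.Fintype.Card
import Mathlib.Data.Fintype.EquivFin
import Mathlib.Tactic.Positivity
import Mathlib.Tactic.Ring
import Mathlib.Tactic.Linarith
import Literature.Computability.Complexity.CardinalityCNF
import Literature.Computability.Complexity.MulCNF
import HarnessLib

/-!
# The projective-plane CNF `planeCNF n`

The width-`≤ 4` CNF over variables `ℕ` asserting *"there is a projective plane of order `n` whose
points are `0, …, v-1` and whose lines are `0, …, v-1`"*, `v = n² + n + 1`, next to the other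
classical hard families `pigeonholeCNF` / `tseitinCNF`
(`Literature/Computability/MetaComplexity/Resolution.lean`). It is the clausal form of the
propositional translation `⟨·⟩_v` [Krajíček 2019, §1.2] of the first-order axioms of an abstract
projective plane [Kiss–Szőnyi 2019, Def. 1.3]:

* **P1∃** every two distinct points lie on a common line,
* **P2∃** every two distinct lines pass through a common point,
* **P1!/P2!** two distinct points do not lie on two distinct common lines
  (uniqueness in P1, equivalently in P2),
* **P3** every line is incident with at least three points, rendered as
  `∀ B ∀ p p' ∃ q (q ≠ p ∧ q ≠ p' ∧ q ∈ B)`,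
* **P4** every point is incident with at least three lines (dually),

over the universe `[v]` serving both as the point set and as the line set; by
[Kiss–Szőnyi 2019, Thm. 1.8, Def. 1.9] a projective plane has `n² + n + 1` points (and as many
lines) iff it has order `n`, so the models of these axioms on `v = n² + n + 1` points and `v` lines
are exactly the projective planes of order `n` (`planeCNF_satisfiable_iff_exists_projectivePlane`).

## Variables and clauses (all indices `< v`, pairs `p < p'`, `B < B'` where indicated)

* incidence atoms `x_(p,B)` ("point `p` lies on line `B`"), index `p * v + B` (`encode_inc`);
* flags `y_(p,p',B) ↔ x_(p,B) ∧ x_(p',B)` (`p < p'`) and dually `y'_(B,B',p) ↔ x_(p,B) ∧ x_(p,B')`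
  (`B < B'`), each by the three clauses of Tseitin's limited extension of a conjunction
  [Krajíček 2019, §5.1] (`flagCNF`);
* P1∃ for `p < p'`: the long clause `⋁_B y_(p,p',B)` split into width-`≤ 3` clauses over fresh
  chain variables `z_(p,p',j)`, `j ≤ v` (`chainCNF`: `z₀`, `¬z_j ∨ ℓ_j ∨ z_{j+1}`, `¬z_v`; the
  intended meaning of `z_j` is "some disjunct of index `≥ j` is true"); P2∃ dually;
* P1!: the 4-clauses `¬x_(p,B) ∨ ¬x_(p',B) ∨ ¬x_(p,B') ∨ ¬x_(p',B')` for `p < p'`, `B < B'`;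
* P3 for every line `B` and all `p, p'` (not necessarily distinct): the clause
  `⋁_{q ∉ {p,p'}} x_(q,B)` split into a width-`≤ 3` chain over fresh `z`-variables; P4 dually.

So `planeCNF n` has width `≤ 4` (`isWidthLE_planeCNF`), `Θ(v⁴) = Θ(n⁸)` clauses
(`length_planeCNF_le`) and `Θ(v⁴)` variables (`numVars_planeCNF_le`, `planeNumVars`).

## Structure of the file

* generic gadgets over any variable type: `flagCNF`, `chainCore`/`chainCNF` with soundness and
  completeness (`chainCNF_sound`, `chainCNF_complete`), `finLtPairs`;
* the structured variable type `PlaneVar v` (seven constructors), its dense numbering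
  `PlaneVar.encode : PlaneVar v → ℕ` (an `Equiv` with `Fin (planeNumVars v)` built from
  `finProdFinEquiv` / `finSumFinEquiv`, hence injective and `< planeNumVars v` for free);
* the clause families (`PlaneCNF.flagFamily`, `existsFamily`, `uniqueFamily`, `thirdFamily`),
  written once for an abstract "side" and instantiated for points and, dually, for lines;
  `projectivePlaneCNF v : CNF (PlaneVar v)` and `planeCNF n := (projectivePlaneCNF v).relabel encode`;
* semantics: `IsPlaneIncidence v I` (the five axioms for an incidence relation
  `I : Fin v → Fin v → Prop`), the canonical assignment `planeAssignment I`, and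
  `satisfiable_projectivePlaneCNF_iff : Satisfiable ↔ ∃ I, IsPlaneIncidence v I`
  (Krajíček's Lemma 1.2.3 for this sentence);
* the bridge to Mathlib's `Configuration.ProjectivePlane`: `IsPlaneIncidence.nonempty_projectivePlane`
  (synthetic verification of Mathlib's axioms incl. `exists_config`),
  `IsPlaneIncidence.of_projectivePlane`, the order computation `projectivePlane_order_eq_of_card`,
  and the main statements `planeCNF_satisfiable_iff`,
  `planeCNF_satisfiable_iff_exists_projectivePlane`, `planeCNF_satisfiable_of_projectivePlane`,
  `two_le_of_planeCNF_satisfiable`, `planeCNF_satisfiable_of_field` / `_of_prime` (PG(2,q) is a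
  witness).

## Design notes

* Mathlib has `Configuration.ProjectivePlane P L` (a class over `[Membership P L]`, data-carrying:
  `mkPoint`/`mkLine`); we do not redefine projective planes — `IsPlaneIncidence` is only the
  relational matrix form in which a CNF can speak about them, and is proved equivalent.
* The P3/P4 families dominate the size (`2 v³` chains of `v + 2` clauses); a cardinality gadget
  (`CardinalityCNF.seqCounter 3`) would be `O(v²)`, but the requesting route asked for plain
  width-3 chains, and the uniqueness family alone already has `(v choose 2)² = Θ(v⁴)` clauses.
* `projectivePlaneCNF 0 = []` is satisfiable while `Fin 0` carries no projective plane, so the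
  generic bridge lemmas assume `0 < v`; `planeCNF n` always has `v = n² + n + 1 ≥ 1`, and
  `planeCNF 0`, `planeCNF 1` are unsatisfiable (`two_le_of_planeCNF_satisfiable`).
* Imports: `CardinalityCNF` only for the clause-evaluation simp set (`Clause.eval_cons`, …) and
  `MulCNF` only for `CNF.numVars_le_of_forall_lt`; both are light.
* Which `planeCNF n` are contradictions for `n ≥ 2` is number theory / finite geometry
  (Bruck–Ryser 1949: `n ≡ 1, 2 (mod 4)` not a sum of two squares; Lam 1989: `n = 10`) and is NOT
  vendored here.

## References

* Gy. Kiss, T. Szőnyi, *Finite Geometries*, CRC Press 2019, Def. 1.3 (axioms P1–P4), Thm. 1.8 and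
  Def. 1.9 (order `n` ⟺ `n² + n + 1` points and lines). [cite: KissSzonyi2019, Def. 1.3]
* J. Krajíček, *Proof Complexity*, CUP 2019, §1.2 (the translation `⟨B⟩_n`, Lemma 1.2.3),
  §5.1 (limited extension, Lemma 5.1.1). [cite: Krajicek2019, §1.2]
* G. S. Tseitin, *On the complexity of derivation in propositional calculus*, 1968
  (extension variables).
-/

namespace Literature.Computability.Complexity

universe u

variable {ν : Type u}

/-! ### Generic gadget 1: the flag (limited extension of a conjunction) -/

/-- The three clauses `¬y ∨ a`, `¬y ∨ b`, `y ∨ ¬a ∨ ¬b` defining the extension variable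
`y ↔ a ∧ b` (Tseitin's limited extension of a conjunction).
[Krajíček 2019, §5.1 (LimExt, case `B = C ∧ D`)] [cite: Krajicek2019, §5.1] -/
def flagCNF (y a b : ν) : CNF ν :=
  [[(y, false), (a, true)], [(y, false), (b, true)], [(y, true), (a, false), (b, false)]]

/-- Semantics of the flag clauses: they hold iff `y` carries the value of `a ∧ b`.
[Krajíček 2019, §5.1, Lemma 5.1.1] [cite: Krajicek2019, §5.1] -/
theorem eval_flagCNF_iff (σ : ν → Bool) (y a b : ν) :
    (flagCNF y a b).eval σ = true ↔ σ y = (σ a && σ b) := by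
  unfold flagCNF
  cases hy : σ y <;> cases ha : σ a <;> cases hb : σ b <;>
    simp [CNF.eval, Literal.eval, hy, ha, hb]

/-- Every flag clause has at most three literals. [Krajíček 2019, §5.1] [cite: Krajicek2019, §5.1] -/
theorem isWidthLE_flagCNF (y a b : ν) : (flagCNF y a b).IsWidthLE 3 := by
  intro c hc
  simp only [flagCNF, List.mem_cons, List.not_mem_nil, or_false] at hc
  rcases hc with rfl | rfl | rfl <;> simp

/-- The flag gadget has three clauses. [Krajíček 2019, §5.1] [cite: Krajicek2019, §5.1] -/
@[simp] theorem length_flagCNF (y a b : ν) : (flagCNF y a b).length = 3 := rfl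

/-! ### Generic gadget 2: splitting a long clause into a width-3 chain -/

/-- The tail of the chain splitting of a long clause: given fresh variables `z j, z (j+1), …` and
the remaining parts `c_j, c_{j+1}, …, c_{k-1}` (each a short list of literals), the clauses
`¬z_j ∨ c_j ∨ z_{j+1}`, …, `¬z_{k-1} ∨ c_{k-1} ∨ z_k` and the terminator `¬z_k`.
[Krajíček 2019, §5.1 (limited extension); folklore reduction CNF ↦ 3CNF] [folklore] -/
def chainCore (z : ℕ → ν) : ℕ → List (Clause ν) → CNF ν
  | j, [] => [[(z j, false)]]
  | j, c :: cs => ((z j, false) :: (c ++ [(z (j + 1), true)])) :: chainCore z (j + 1) cs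

/-- The chain splitting of the long clause `c₀ ∨ c₁ ∨ ⋯ ∨ c_{k-1}` (the `cᵢ` are short lists of
literals, typically singletons) over fresh variables `z 0, …, z k`: the unit clause `z₀`, the
clauses `¬z_j ∨ c_j ∨ z_{j+1}` (`j < k`) and the unit clause `¬z_k`. The intended value of `z_j`
is "some part of index `≥ j` contains a true literal"; the gadget is satisfiable over the `z`'s
iff the long clause is true (`chainCNF_sound`, `chainCNF_complete`). Width `2 +` the maximal
part length. [folklore reduction CNF ↦ 3CNF via extension variables; Krajíček 2019, §5.1]
[folklore] -/
def chainCNF (z : ℕ → ν) (parts : List (Clause ν)) : CNF ν :=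
  [(z 0, true)] :: chainCore z 0 parts

/-- The value of a concatenated clause is the disjunction of the values. [folklore] -/
theorem Clause.eval_append (σ : ν → Bool) (c d : Clause ν) :
    Clause.eval σ (c ++ d) = (Clause.eval σ c || Clause.eval σ d) :=
  List.any_append

/-- Soundness of the chain tail: if all its clauses hold and `z_j` is true, some remaining part
contains a true literal. [folklore] -/
theorem chainCore_sound {σ : ν → Bool} {z : ℕ → ν} :
    ∀ (j : ℕ) (cs : List (Clause ν)), (chainCore z j cs).eval σ = true → σ (z j) = true →
      ∃ c ∈ cs, Clause.eval σ c = true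
  | j, [], h, hz => by
    simp [chainCore, CNF.eval, Literal.eval, hz] at h
  | j, c :: cs, h, hz => by
    simp only [chainCore, CNF.eval_cons, Bool.and_eq_true] at h
    obtain ⟨h₁, h₂⟩ := h
    simp only [Clause.eval_cons, Clause.eval_append, Literal.eval_mk_false, Literal.eval_mk_true,
      hz, Bool.not_true, Bool.false_or, Clause.eval_nil, Bool.or_false, Bool.or_eq_true] at h₁
    rcases h₁ with h₁ | h₁
    · exact ⟨c, List.mem_cons_self, h₁⟩
    · obtain ⟨c', hc', hc'e⟩ := chainCore_sound (j + 1) cs h₂ h₁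
      exact ⟨c', List.mem_cons_of_mem _ hc', hc'e⟩

/-- **Soundness of the chain gadget**: an assignment satisfying `chainCNF z parts` makes some
part (hence the long clause) true. [folklore] -/
theorem chainCNF_sound {σ : ν → Bool} {z : ℕ → ν} {parts : List (Clause ν)}
    (h : (chainCNF z parts).eval σ = true) : ∃ c ∈ parts, Clause.eval σ c = true := by
  simp only [chainCNF, CNF.eval_cons, Bool.and_eq_true, Clause.eval_cons, Clause.eval_nil,
    Literal.eval_mk_true, Bool.or_false] at h
  exact chainCore_sound 0 parts h.2 h.1

/-- Completeness of the chain tail: if every `z_{j+i}` carries its intended value "some part of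
index `≥ i` (among the remaining ones) has a true literal", all tail clauses hold. [folklore] -/
theorem chainCore_complete {σ : ν → Bool} {z : ℕ → ν} :
    ∀ (j : ℕ) (cs : List (Clause ν)),
      (∀ i ≤ cs.length, σ (z (j + i)) = (cs.drop i).any (Clause.eval σ)) →
      (chainCore z j cs).eval σ = true
  | j, [], h => by
    have h0 := h 0 le_rfl
    simp only [Nat.add_zero, List.drop_nil, List.any_nil] at h0
    simp [chainCore, CNF.eval, Literal.eval, h0]
  | j, c :: cs, h => by
    have h0 := h 0 (Nat.zero_le _)
    have h1 := h 1 (by simp)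
    simp only [Nat.add_zero, List.drop_zero, List.any_cons] at h0
    simp only [List.drop_succ_cons, List.drop_zero] at h1
    have ih := chainCore_complete (j + 1) cs fun i hi => by
      have := h (i + 1) (by simpa using hi)
      simpa [Nat.add_assoc, Nat.add_comm 1 i] using this
    simp only [chainCore, CNF.eval_cons, ih, Bool.and_true, Clause.eval_cons, Clause.eval_append,
      Literal.eval_mk_false, Literal.eval_mk_true, Clause.eval_nil, Bool.or_false, h0, h1]
    cases Clause.eval σ c <;> cases cs.any (Clause.eval σ) <;> rfl

/-- **Completeness of the chain gadget**: if the long clause is true and every `z_i` (`i ≤ k`)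
carries its intended value "some part of index `≥ i` has a true literal", then `chainCNF z parts`
holds. (No freshness hypothesis is needed in this formulation.) [folklore] -/
theorem chainCNF_complete {σ : ν → Bool} {z : ℕ → ν} {parts : List (Clause ν)}
    (hz : ∀ i ≤ parts.length, σ (z i) = (parts.drop i).any (Clause.eval σ))
    (htrue : parts.any (Clause.eval σ) = true) : (chainCNF z parts).eval σ = true := by
  have h0 := hz 0 (Nat.zero_le _)
  rw [List.drop_zero, htrue] at h0
  have hc := chainCore_complete (σ := σ) (z := z) 0 parts fun i hi => by simpa using hz i hi
  simp [chainCNF, CNF.eval_cons, hc, Clause.eval_cons, Literal.eval, h0]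

/-- The chain tail on `k` parts has `k + 1` clauses. [folklore] -/
theorem length_chainCore (z : ℕ → ν) : ∀ (j : ℕ) (cs : List (Clause ν)),
    (chainCore z j cs).length = cs.length + 1
  | _, [] => rfl
  | j, _ :: cs => by simp [chainCore, length_chainCore z (j + 1) cs]

/-- The chain gadget on `k` parts has `k + 2` clauses. [folklore] -/
@[simp] theorem length_chainCNF (z : ℕ → ν) (parts : List (Clause ν)) :
    (chainCNF z parts).length = parts.length + 2 := by
  simp [chainCNF, length_chainCore]

/-- Width of the chain tail: parts of length `≤ k` give clauses of length `≤ k + 2`. [folklore] -/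
theorem chainCore_width {z : ℕ → ν} {k : ℕ} : ∀ (j : ℕ) (cs : List (Clause ν)),
    (∀ c ∈ cs, c.length ≤ k) → ∀ d ∈ chainCore z j cs, d.length ≤ k + 2
  | j, [], _, d, hd => by
    simp only [chainCore, List.mem_singleton] at hd
    subst hd
    simp
  | j, c :: cs, h, d, hd => by
    simp only [chainCore, List.mem_cons] at hd
    rcases hd with rfl | hd
    · have := h c List.mem_cons_self
      simp only [List.length_cons, List.length_append, List.length_nil]
      omega
    · exact chainCore_width (j + 1) cs (fun c' hc' => h c' (List.mem_cons_of_mem _ hc')) d hd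

/-- **Width of the chain gadget**: if every part has at most `k` literals, every clause of the
chain has at most `k + 2`. [folklore] -/
theorem isWidthLE_chainCNF {z : ℕ → ν} {k : ℕ} {parts : List (Clause ν)}
    (h : ∀ c ∈ parts, c.length ≤ k) : (chainCNF z parts).IsWidthLE (k + 2) := by
  intro d hd
  simp only [chainCNF, List.mem_cons] at hd
  rcases hd with rfl | hd
  · simp
  · exact chainCore_width 0 parts h d hd

/-! ### Small list helpers -/

/-- The list of ordered pairs `(a, b)` of `Fin v` with `a < b` (grouped by `b`). [folklore] -/
def finLtPairs (v : ℕ) : List (Fin v × Fin v) :=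
  (List.finRange v).flatMap fun b => ((List.finRange v).filter (· < b)).map fun a => (a, b)

/-- Membership in `finLtPairs`: exactly the pairs with first component below the second.
[folklore] -/
@[simp] theorem mem_finLtPairs {v : ℕ} {ab : Fin v × Fin v} :
    ab ∈ finLtPairs v ↔ ab.1 < ab.2 := by
  rcases ab with ⟨a, b⟩
  simp only [finLtPairs, List.mem_flatMap, List.mem_finRange, List.mem_map, List.mem_filter,
    decide_eq_true_eq, true_and, Prod.mk.injEq]
  constructor
  · rintro ⟨b', a', ha', rfl, rfl⟩
    exact ha'
  · intro h
    exact ⟨b, a, h, rfl, rfl⟩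

/-- `finLtPairs v` has at most `v * v` elements. [folklore] -/
theorem length_finLtPairs_le (v : ℕ) : (finLtPairs v).length ≤ v * v := by
  unfold finLtPairs
  rw [List.length_flatMap]
  have : ∀ b ∈ List.finRange v,
      (fun b : Fin v => (((List.finRange v).filter (· < b)).map fun a => (a, b)).length) b ≤ v := by
    intro b _
    simp only [List.length_map]
    exact (List.length_filter_le _ _).trans (by simp)
  refine (List.sum_le_card_nsmul _ v ?_).trans (by simp)
  intro x hx
  obtain ⟨b, hb, rfl⟩ := List.mem_map.1 hx
  exact this b hb

/-- A CNF assembled by `flatMap` holds iff every piece holds. [folklore] -/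
theorem CNF.eval_flatMap_eq_true_iff {α : Type*} (l : List α) (f : α → CNF ν) (σ : ν → Bool) :
    CNF.eval (l.flatMap f) σ = true ↔ ∀ x ∈ l, (f x).eval σ = true := by
  simp only [CNF.eval_eq_true_iff, List.mem_flatMap]
  constructor
  · intro h x hx c hc
    exact h c ⟨x, hx, hc⟩
  · rintro h c ⟨x, hx, hc⟩
    exact h x hx c hc

/-- A CNF assembled by `map` (one clause per index) holds iff every clause holds. [folklore] -/
theorem CNF.eval_map_eq_true_iff {α : Type*} (l : List α) (f : α → Clause ν) (σ : ν → Bool) :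
    CNF.eval (l.map f) σ = true ↔ ∀ x ∈ l, Clause.eval σ (f x) = true := by
  simp only [CNF.eval_eq_true_iff, List.forall_mem_map]

/-- Relabelling preserves clause widths. [folklore] -/
theorem CNF.IsWidthLE.relabel {μ : Type*} {k : ℕ} {φ : CNF ν} (h : φ.IsWidthLE k) (f : ν → μ) :
    (φ.relabel f).IsWidthLE k := by
  intro c hc
  obtain ⟨c₀, hc₀, rfl⟩ := CNF.mem_relabel_iff.1 hc
  simpa [Clause.relabel] using h c₀ hc₀

/-- Relabelling preserves the number of clauses. [folklore] -/
@[simp] theorem CNF.length_relabel {μ : Type*} (f : ν → μ) (φ : CNF ν) :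
    (φ.relabel f).length = φ.length := by
  simp [CNF.relabel]

/-! ### The structured variables of the plane CNF -/

/-- The variables of the projective-plane CNF on `v` points and `v` lines:
* `inc p B` — the incidence atom `x_(p,B)`, "point `p` lies on line `B`";
* `flagP p p' B` — the flag `y_(p,p',B) ↔ x_(p,B) ∧ x_(p',B)` (used for `p < p'`);
* `flagL B B' p` — the dual flag `y'_(B,B',p) ↔ x_(p,B) ∧ x_(p,B')` (used for `B < B'`);
* `zLine p p' j` — chain variable `j ≤ v` of the clause `⋁_B y_(p,p',B)` (P1∃);
* `zPoint B B' j` — chain variable of `⋁_p y'_(B,B',p)` (P2∃);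
* `zThirdP B p p' j` — chain variable of `⋁_{q ∉ {p,p'}} x_(q,B)` (P3);
* `zThirdL p B B' j` — chain variable of `⋁_{C ∉ {B,B'}} x_(p,C)` (P4).
[Krajíček 2019, §1.2 (atoms `r_{i,j}` of the translation), §5.1 (extension atoms)]
[cite: Krajicek2019, §1.2] -/
inductive PlaneVar (v : ℕ) : Type
  /-- incidence atom `x_(p,B)` -/
  | inc (p B : Fin v)
  /-- flag `y_(p,p',B) ↔ x_(p,B) ∧ x_(p',B)` -/
  | flagP (p p' B : Fin v)
  /-- dual flag `y'_(B,B',p) ↔ x_(p,B) ∧ x_(p,B')` -/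
  | flagL (B B' p : Fin v)
  /-- chain variable of "points `p, p'` have a common line" -/
  | zLine (p p' : Fin v) (j : Fin (v + 1))
  /-- chain variable of "lines `B, B'` have a common point" -/
  | zPoint (B B' : Fin v) (j : Fin (v + 1))
  /-- chain variable of "line `B` has a point outside `{p, p'}`" -/
  | zThirdP (B p p' : Fin v) (j : Fin (v + 1))
  /-- chain variable of "point `p` has a line outside `{B, B'}`" -/
  | zThirdL (p B B' : Fin v) (j : Fin (v + 1))
  deriving DecidableEq, Repr

namespace PlaneVar

variable {v : ℕ}

/-- The "shape" of `PlaneVar v` as a sum of products of `Fin`'s, in constructor order (used to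
number the variables densely). [folklore] -/
abbrev Shape (v : ℕ) : Type :=
  (Fin v × Fin v) ⊕ (Fin v × Fin v × Fin v) ⊕ (Fin v × Fin v × Fin v) ⊕
    (Fin v × Fin v × Fin (v + 1)) ⊕ (Fin v × Fin v × Fin (v + 1)) ⊕
    (Fin v × Fin v × Fin v × Fin (v + 1)) ⊕ (Fin v × Fin v × Fin v × Fin (v + 1))

/-- From a variable to its shape. [folklore] -/
def toShape : PlaneVar v → Shape v
  | inc p B => Sum.inl (p, B)
  | flagP p p' B => Sum.inr (Sum.inl (p, p', B))
  | flagL B B' p => Sum.inr (Sum.inr (Sum.inl (B, B', p)))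
  | zLine p p' j => Sum.inr (Sum.inr (Sum.inr (Sum.inl (p, p', j))))
  | zPoint B B' j => Sum.inr (Sum.inr (Sum.inr (Sum.inr (Sum.inl (B, B', j)))))
  | zThirdP B p p' j => Sum.inr (Sum.inr (Sum.inr (Sum.inr (Sum.inr (Sum.inl (B, p, p', j))))))
  | zThirdL p B B' j => Sum.inr (Sum.inr (Sum.inr (Sum.inr (Sum.inr (Sum.inr (p, B, B', j))))))

/-- From a shape to the variable. [folklore] -/
def ofShape : Shape v → PlaneVar v
  | Sum.inl (p, B) => inc p B
  | Sum.inr (Sum.inl (p, p', B)) => flagP p p' B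
  | Sum.inr (Sum.inr (Sum.inl (B, B', p))) => flagL B B' p
  | Sum.inr (Sum.inr (Sum.inr (Sum.inl (p, p', j)))) => zLine p p' j
  | Sum.inr (Sum.inr (Sum.inr (Sum.inr (Sum.inl (B, B', j))))) => zPoint B B' j
  | Sum.inr (Sum.inr (Sum.inr (Sum.inr (Sum.inr (Sum.inl (B, p, p', j)))))) => zThirdP B p p' j
  | Sum.inr (Sum.inr (Sum.inr (Sum.inr (Sum.inr (Sum.inr (p, B, B', j)))))) => zThirdL p B B' j

/-- `PlaneVar v` is equivalent to its shape. [folklore] -/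
def shapeEquiv : PlaneVar v ≃ Shape v where
  toFun := toShape
  invFun := ofShape
  left_inv x := by cases x <;> rfl
  right_inv s := by
    rcases s with ⟨p, B⟩ | ⟨p, p', B⟩ | ⟨B, B', p⟩ | ⟨p, p', j⟩ | ⟨B, B', j⟩ | ⟨B, p, p', j⟩ |
      ⟨p, B, B', j⟩ <;> rfl

end PlaneVar

/-- The number of variables of the plane CNF on `v` points and lines: the sizes of the seven
blocks `x` (`v²`), `y` (`v³`), `y'` (`v³`), `z` for P1∃ (`v²(v+1)`), for P2∃ (`v²(v+1)`), for P3
(`v³(v+1)`), for P4 (`v³(v+1)`); in total `2v⁴ + 6v³ + 3v²`. (An `abbrev`, so that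
`Fin (planeNumVars v)` unfolds reducibly to the iterated sum the numbering `Equiv` produces.)
[folklore] -/
abbrev planeNumVars (v : ℕ) : ℕ :=
  v * v + (v * (v * v) + (v * (v * v) + (v * (v * (v + 1)) + (v * (v * (v + 1)) +
    (v * (v * (v * (v + 1))) + v * (v * (v * (v + 1))))))))

namespace PlaneVar

variable {v : ℕ}

/-- Mixed-radix numbering of a triple. [folklore] -/
def fin3Equiv (a b c : ℕ) : Fin a × Fin b × Fin c ≃ Fin (a * (b * c)) :=
  (Equiv.prodCongr (Equiv.refl _) finProdFinEquiv).trans finProdFinEquiv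

/-- Mixed-radix numbering of a quadruple. [folklore] -/
def fin4Equiv (a b c d : ℕ) : Fin a × Fin b × Fin c × Fin d ≃ Fin (a * (b * (c * d))) :=
  (Equiv.prodCongr (Equiv.refl _) (fin3Equiv b c d)).trans finProdFinEquiv

/-- Dense numbering of the shapes: block after block, each block in row-major (mixed-radix)
order. [folklore] -/
def shapeFinEquiv (v : ℕ) : Shape v ≃ Fin (planeNumVars v) :=
  (Equiv.sumCongr finProdFinEquiv <| Equiv.sumCongr (fin3Equiv v v v) <|
    Equiv.sumCongr (fin3Equiv v v v) <| Equiv.sumCongr (fin3Equiv v v (v + 1)) <|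
    Equiv.sumCongr (fin3Equiv v v (v + 1)) <|
    Equiv.sumCongr (fin4Equiv v v v (v + 1)) (fin4Equiv v v v (v + 1))).trans <|
    (Equiv.sumCongr (Equiv.refl _) <| (Equiv.sumCongr (Equiv.refl _) <|
      (Equiv.sumCongr (Equiv.refl _) <| (Equiv.sumCongr (Equiv.refl _) <|
        (Equiv.sumCongr (Equiv.refl _) finSumFinEquiv).trans finSumFinEquiv).trans
          finSumFinEquiv).trans finSumFinEquiv).trans finSumFinEquiv).trans finSumFinEquiv

/-- The variables of the plane CNF are in bijection with `Fin (planeNumVars v)`. [folklore] -/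
def varEquiv (v : ℕ) : PlaneVar v ≃ Fin (planeNumVars v) :=
  shapeEquiv.trans (shapeFinEquiv v)

/-- The variable numbering `PlaneVar v → ℕ` used by `planeCNF`: `x_(p,B) ↦ p * v + B`
(`encode_inc`), then the blocks `y`, `y'`, `z` (P1∃), `z` (P2∃), `z` (P3), `z` (P4) in this order,
each in row-major order of its indices, the chain index `j ≤ v` last; e.g.
`y_(p,p',B) ↦ v² + p v² + p' v + B` and `z_(p,p',j) ↦ v² + 2v³ + (p v + p') (v + 1) + j`.
[folklore] -/
def encode (x : PlaneVar v) : ℕ :=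
  varEquiv v x

/-- The numbering is injective. [folklore] -/
theorem encode_injective : Function.Injective (encode (v := v)) :=
  Fin.val_injective.comp (varEquiv v).injective

/-- Every variable number is below `planeNumVars v`. [folklore] -/
theorem encode_lt (x : PlaneVar v) : encode x < planeNumVars v :=
  (varEquiv v x).isLt

/-- The incidence atom `x_(p,B)` is variable number `p * v + B` (the convention of the requesting
route, matching the cell numbering `X (p * v + B)` of the design polynomial systems). [folklore] -/
@[simp] theorem encode_inc (p B : Fin v) : encode (inc p B) = (p : ℕ) * v + B := by
  simp only [encode, varEquiv, shapeEquiv, toShape, shapeFinEquiv, Equiv.trans_apply,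
    Equiv.coe_fn_mk, Equiv.sumCongr_apply, Sum.map_inl, Equiv.refl_apply,
    finSumFinEquiv_apply_left, Fin.val_castAdd, finProdFinEquiv_apply_val]
  ring

/-- `PlaneVar v` is a finite type (via `varEquiv`). [folklore] -/
instance : Fintype (PlaneVar v) :=
  Fintype.ofEquiv _ (varEquiv v).symm

/-- There are `planeNumVars v` variables. [folklore] -/
theorem card_planeVar (v : ℕ) : Fintype.card (PlaneVar v) = planeNumVars v := by
  rw [Fintype.card_congr (varEquiv v), Fintype.card_fin]

end PlaneVar

/-- The saturating chain index `min j v : Fin (v + 1)` (the chains have `v` parts, so only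
`j ≤ v` occurs, where it is `j`; the same clamping as `AlgebraicComplexity.slotVar`, not imported
for its heavy closure). [folklore] -/
def chainIdx (v j : ℕ) : Fin (v + 1) :=
  ⟨min j v, by omega⟩


/-! ### The clause families (generic in the side: points/lines or lines/points)

In this section `ι a b : ν` is the incidence atom "first-sort element `a` is incident with
second-sort element `b`" (for the point side `ι p B = x_(p,B)`, for the line side
`ι B p = x_(p,B)`), `fl a a' b` the flag of the pair `a < a'` and `b`, and `zc`, `z3` supply the
chain variables. -/

namespace PlaneCNF

variable {v : ℕ}

/-- The flag family of a side: for all `a < a'` and all `b`, the three clauses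
`fl a a' b ↔ ι a b ∧ ι a' b`. [Krajíček 2019, §5.1] [cite: Krajicek2019, §5.1] -/
def flagFamily (ι : Fin v → Fin v → ν) (fl : Fin v → Fin v → Fin v → ν) : CNF ν :=
  (finLtPairs v).flatMap fun aa => (List.finRange v).flatMap fun b =>
    flagCNF (fl aa.1 aa.2 b) (ι aa.1 b) (ι aa.2 b)

/-- Semantics of the flag family. [Krajíček 2019, §5.1, Lemma 5.1.1] [cite: Krajicek2019, §5.1] -/
theorem eval_flagFamily_iff (σ : ν → Bool) (ι : Fin v → Fin v → ν)
    (fl : Fin v → Fin v → Fin v → ν) :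
    (flagFamily ι fl).eval σ = true ↔
      ∀ a a' : Fin v, a < a' → ∀ b, σ (fl a a' b) = (σ (ι a b) && σ (ι a' b)) := by
  simp only [flagFamily, CNF.eval_flatMap_eq_true_iff, mem_finLtPairs, List.mem_finRange,
    true_implies, eval_flagCNF_iff, Prod.forall]

/-- The existence family of a side (P1∃ / P2∃): for all `a < a'`, the chain splitting of the
long clause `⋁_b fl a a' b` ("`a` and `a'` have a common second-sort element").
[Kiss–Szőnyi 2019, Def. 1.3 (P1, P2, existence part); Krajíček 2019, §1.2]
[cite: KissSzonyi2019, Def. 1.3] -/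
def existsFamily (fl : Fin v → Fin v → Fin v → ν) (zc : Fin v → Fin v → ℕ → ν) : CNF ν :=
  (finLtPairs v).flatMap fun aa =>
    chainCNF (zc aa.1 aa.2) ((List.finRange v).map fun b => [(fl aa.1 aa.2 b, true)])

/-- Soundness of the existence family: some flag of every pair `a < a'` is true.
[Kiss–Szőnyi 2019, Def. 1.3] [cite: KissSzonyi2019, Def. 1.3] -/
theorem exists_flag_of_eval_existsFamily {σ : ν → Bool} {fl : Fin v → Fin v → Fin v → ν}
    {zc : Fin v → Fin v → ℕ → ν} (h : (existsFamily fl zc).eval σ = true)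
    {a a' : Fin v} (haa : a < a') : ∃ b, σ (fl a a' b) = true := by
  simp only [existsFamily, CNF.eval_flatMap_eq_true_iff, mem_finLtPairs, Prod.forall] at h
  obtain ⟨c, hc, hce⟩ := chainCNF_sound (h a a' haa)
  obtain ⟨b, -, rfl⟩ := List.mem_map.1 hc
  exact ⟨b, by simpa using hce⟩

/-- Completeness of the existence family: it holds if every pair `a < a'` has a true flag and
the chain variables carry their intended values. [folklore] -/
theorem eval_existsFamily_of {σ : ν → Bool} {fl : Fin v → Fin v → Fin v → ν}
    {zc : Fin v → Fin v → ℕ → ν}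
    (hex : ∀ a a' : Fin v, a < a' → ∃ b, σ (fl a a' b) = true)
    (hz : ∀ a a' : Fin v, a < a' → ∀ i ≤ v,
      σ (zc a a' i) = ((List.finRange v).drop i).any fun b => σ (fl a a' b)) :
    (existsFamily fl zc).eval σ = true := by
  simp only [existsFamily, CNF.eval_flatMap_eq_true_iff, mem_finLtPairs, Prod.forall]
  intro a a' haa
  apply chainCNF_complete
  · intro i hi
    rw [List.length_map, List.length_finRange] at hi
    rw [hz a a' haa i hi, ← List.map_drop, List.any_map]
    congr 1
    funext b
    simp
  · obtain ⟨b, hb⟩ := hex a a' haa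
    exact List.any_eq_true.2 ⟨[(fl a a' b, true)], List.mem_map.2 ⟨b, List.mem_finRange b, rfl⟩,
      by simpa using hb⟩

/-- The uniqueness family (P1!, equivalently P2!): for `p < p'` and `B < B'` the 4-clause
`¬x_(p,B) ∨ ¬x_(p',B) ∨ ¬x_(p,B') ∨ ¬x_(p',B')` ("two distinct points are not both on two distinct
lines"). [Kiss–Szőnyi 2019, Def. 1.3 (P1, P2, uniqueness part)] [cite: KissSzonyi2019, Def. 1.3] -/
def uniqueFamily (ι : Fin v → Fin v → ν) : CNF ν :=
  (finLtPairs v).flatMap fun pp => (finLtPairs v).map fun BB =>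
    [(ι pp.1 BB.1, false), (ι pp.2 BB.1, false), (ι pp.1 BB.2, false), (ι pp.2 BB.2, false)]

/-- Semantics of the uniqueness family. [Kiss–Szőnyi 2019, Def. 1.3] [cite: KissSzonyi2019, Def. 1.3] -/
theorem eval_uniqueFamily_iff (σ : ν → Bool) (ι : Fin v → Fin v → ν) :
    (uniqueFamily ι).eval σ = true ↔ ∀ p p' : Fin v, p < p' → ∀ B B' : Fin v, B < B' →
      ¬ (σ (ι p B) = true ∧ σ (ι p' B) = true ∧ σ (ι p B') = true ∧ σ (ι p' B') = true) := by
  simp only [uniqueFamily, CNF.eval_flatMap_eq_true_iff, CNF.eval_map_eq_true_iff,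
    mem_finLtPairs, Prod.forall]
  refine forall₂_congr fun p p' => forall_congr' fun _ => forall₂_congr fun B B' =>
    forall_congr' fun _ => ?_
  cases h₁ : σ (ι p B) <;> cases h₂ : σ (ι p' B) <;> cases h₃ : σ (ι p B') <;>
    cases h₄ : σ (ι p' B') <;> simp [Clause.eval, Literal.eval, h₁, h₂, h₃, h₄]

/-- The parts of the P3/P4 long clause of `b` avoiding `a, a'`: position `c` carries the literal
`ι c b` if `c ∉ {a, a'}` and nothing otherwise. [Kiss–Szőnyi 2019, Def. 1.3 (P3, P4)]
[cite: KissSzonyi2019, Def. 1.3] -/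
def thirdParts (ι : Fin v → Fin v → ν) (b a a' : Fin v) : List (Clause ν) :=
  (List.finRange v).map fun c => if c ≠ a ∧ c ≠ a' then [(ι c b, true)] else []

/-- The value of a P3/P4 part. [folklore] -/
theorem eval_thirdPart (σ : ν → Bool) (ι : Fin v → Fin v → ν) (b a a' c : Fin v) :
    Clause.eval σ (if c ≠ a ∧ c ≠ a' then [(ι c b, true)] else []) =
      (decide (c ≠ a ∧ c ≠ a') && σ (ι c b)) := by
  by_cases h : c ≠ a ∧ c ≠ a' <;> simp [h]

/-- Every P3/P4 part has at most one literal. [folklore] -/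
theorem length_le_of_mem_thirdParts {ι : Fin v → Fin v → ν} {b a a' : Fin v} {c : Clause ν}
    (hc : c ∈ thirdParts ι b a a') : c.length ≤ 1 := by
  obtain ⟨x, -, rfl⟩ := List.mem_map.1 hc
  split_ifs <;> simp

/-- The "third element" family of a side (P3 / P4): for every `b` and all `a, a'` (not
necessarily distinct) the chain splitting of `⋁_{c ∉ {a,a'}} ι c b` — "`b` is incident with an
element outside `{a, a'}`", i.e. with at least three elements.
[Kiss–Szőnyi 2019, Def. 1.3 (P3, P4)] [cite: KissSzonyi2019, Def. 1.3] -/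
def thirdFamily (ι : Fin v → Fin v → ν) (z3 : Fin v → Fin v → Fin v → ℕ → ν) : CNF ν :=
  (List.finRange v).flatMap fun b => (List.finRange v).flatMap fun a =>
    (List.finRange v).flatMap fun a' => chainCNF (z3 b a a') (thirdParts ι b a a')

/-- Soundness of the third-element family. [Kiss–Szőnyi 2019, Def. 1.3] [cite: KissSzonyi2019, Def. 1.3] -/
theorem exists_third_of_eval_thirdFamily {σ : ν → Bool} {ι : Fin v → Fin v → ν}
    {z3 : Fin v → Fin v → Fin v → ℕ → ν} (h : (thirdFamily ι z3).eval σ = true)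
    (b a a' : Fin v) : ∃ c, c ≠ a ∧ c ≠ a' ∧ σ (ι c b) = true := by
  simp only [thirdFamily, CNF.eval_flatMap_eq_true_iff, List.mem_finRange, true_implies] at h
  obtain ⟨cl, hcl, hcle⟩ := chainCNF_sound (h b a a')
  obtain ⟨c, -, rfl⟩ := List.mem_map.1 hcl
  rw [eval_thirdPart] at hcle
  simp only [Bool.and_eq_true, decide_eq_true_eq] at hcle
  exact ⟨c, hcle.1.1, hcle.1.2, hcle.2⟩

/-- Completeness of the third-element family. [folklore] -/
theorem eval_thirdFamily_of {σ : ν → Bool} {ι : Fin v → Fin v → ν}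
    {z3 : Fin v → Fin v → Fin v → ℕ → ν}
    (hex : ∀ b a a' : Fin v, ∃ c, c ≠ a ∧ c ≠ a' ∧ σ (ι c b) = true)
    (hz : ∀ b a a' : Fin v, ∀ i ≤ v, σ (z3 b a a' i) =
      ((List.finRange v).drop i).any fun c => decide (c ≠ a ∧ c ≠ a') && σ (ι c b)) :
    (thirdFamily ι z3).eval σ = true := by
  simp only [thirdFamily, CNF.eval_flatMap_eq_true_iff, List.mem_finRange, true_implies]
  intro b a a'
  apply chainCNF_complete
  · intro i hi
    rw [thirdParts, List.length_map, List.length_finRange] at hi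
    rw [hz b a a' i hi, thirdParts, ← List.map_drop, List.any_map]
    congr 1
    funext c
    exact (eval_thirdPart σ ι b a a' c).symm
  · obtain ⟨c, hca, hca', hc⟩ := hex b a a'
    refine List.any_eq_true.2 ⟨_, List.mem_map.2 ⟨c, List.mem_finRange c, rfl⟩, ?_⟩
    rw [eval_thirdPart]
    simp [hca, hca', hc]

/-- Width of the flag family: `3`. [folklore] -/
theorem isWidthLE_flagFamily (ι : Fin v → Fin v → ν) (fl : Fin v → Fin v → Fin v → ν) :
    (flagFamily ι fl).IsWidthLE 3 := by
  intro c hc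
  simp only [flagFamily, List.mem_flatMap] at hc
  obtain ⟨aa, -, b, -, hc⟩ := hc
  exact isWidthLE_flagCNF _ _ _ c hc

/-- Width of the existence family: `3`. [folklore] -/
theorem isWidthLE_existsFamily (fl : Fin v → Fin v → Fin v → ν) (zc : Fin v → Fin v → ℕ → ν) :
    (existsFamily fl zc).IsWidthLE 3 := by
  intro c hc
  simp only [existsFamily, List.mem_flatMap] at hc
  obtain ⟨aa, -, hc⟩ := hc
  refine isWidthLE_chainCNF (k := 1) (fun d hd => ?_) c hc
  obtain ⟨b, -, rfl⟩ := List.mem_map.1 hd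
  simp

/-- Width of the uniqueness family: `4`. [folklore] -/
theorem isWidthLE_uniqueFamily (ι : Fin v → Fin v → ν) : (uniqueFamily ι).IsWidthLE 4 := by
  intro c hc
  simp only [uniqueFamily, List.mem_flatMap, List.mem_map] at hc
  obtain ⟨pp, -, BB, -, rfl⟩ := hc
  simp

/-- Width of the third-element family: `3`. [folklore] -/
theorem isWidthLE_thirdFamily (ι : Fin v → Fin v → ν) (z3 : Fin v → Fin v → Fin v → ℕ → ν) :
    (thirdFamily ι z3).IsWidthLE 3 := by
  intro c hc
  simp only [thirdFamily, List.mem_flatMap] at hc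
  obtain ⟨b, -, a, -, a', -, hc⟩ := hc
  exact isWidthLE_chainCNF (k := 1) (fun d hd => length_le_of_mem_thirdParts hd) c hc

/-- Size of the flag family: at most `3 v³` clauses. [folklore] -/
theorem length_flagFamily_le (ι : Fin v → Fin v → ν) (fl : Fin v → Fin v → Fin v → ν) :
    (flagFamily ι fl).length ≤ v * v * (v * 3) := by
  unfold flagFamily
  rw [List.length_flatMap]
  refine (List.sum_le_card_nsmul _ (v * 3) ?_).trans ?_
  · intro x hx
    obtain ⟨aa, -, rfl⟩ := List.mem_map.1 hx
    simp [List.length_flatMap]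
  · simpa [smul_eq_mul] using Nat.mul_le_mul_right (v * 3) (length_finLtPairs_le v)

/-- Size of the existence family: at most `v² (v + 2)` clauses. [folklore] -/
theorem length_existsFamily_le (fl : Fin v → Fin v → Fin v → ν) (zc : Fin v → Fin v → ℕ → ν) :
    (existsFamily fl zc).length ≤ v * v * (v + 2) := by
  unfold existsFamily
  rw [List.length_flatMap]
  refine (List.sum_le_card_nsmul _ (v + 2) ?_).trans ?_
  · intro x hx
    obtain ⟨aa, -, rfl⟩ := List.mem_map.1 hx
    simp
  · simpa [smul_eq_mul] using Nat.mul_le_mul_right (v + 2) (length_finLtPairs_le v)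

/-- Size of the uniqueness family: at most `v⁴` clauses. [folklore] -/
theorem length_uniqueFamily_le (ι : Fin v → Fin v → ν) :
    (uniqueFamily ι).length ≤ v * v * (v * v) := by
  unfold uniqueFamily
  rw [List.length_flatMap]
  refine (List.sum_le_card_nsmul _ (v * v) ?_).trans ?_
  · intro x hx
    obtain ⟨aa, -, rfl⟩ := List.mem_map.1 hx
    simpa using length_finLtPairs_le v
  · simpa [smul_eq_mul] using Nat.mul_le_mul_right (v * v) (length_finLtPairs_le v)

/-- Size of the third-element family: exactly `v³ (v + 2)` clauses. [folklore] -/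
theorem length_thirdFamily (ι : Fin v → Fin v → ν) (z3 : Fin v → Fin v → Fin v → ℕ → ν) :
    (thirdFamily ι z3).length = v * (v * (v * (v + 2))) := by
  simp [thirdFamily, thirdParts, List.length_flatMap, List.sum_replicate, List.map_const']

end PlaneCNF

/-! ### The plane CNF over structured variables, and over `ℕ` -/

open PlaneCNF PlaneVar in
/-- The projective-plane CNF on `v` points and `v` lines over the structured variables
`PlaneVar v`: flags (points side, lines side), P1∃, P2∃, P1!, P3, P4 — the clausal form of the
`⟨·⟩_v`-translation of axioms P1–P4 of [Kiss–Szőnyi 2019, Def. 1.3] with Tseitin extension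
variables for the conjunctions and for splitting the long disjunctions.
[Kiss–Szőnyi 2019, Def. 1.3; Krajíček 2019, §1.2, §5.1] [cite: KissSzonyi2019, Def. 1.3] -/
def projectivePlaneCNF (v : ℕ) : CNF (PlaneVar v) :=
  flagFamily inc flagP ++
  flagFamily (fun B p => inc p B) flagL ++
  existsFamily flagP (fun p p' j => zLine p p' (chainIdx v j)) ++
  existsFamily flagL (fun B B' j => zPoint B B' (chainIdx v j)) ++
  uniqueFamily inc ++
  thirdFamily inc (fun B p p' j => zThirdP B p p' (chainIdx v j)) ++
  thirdFamily (fun B p => inc p B) (fun p B B' j => zThirdL p B B' (chainIdx v j))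

/-- **The plane CNF `planeCNF n`**: the width-`≤ 4` CNF over variables `ℕ` asserting a projective
plane of order `n` on the points `0, …, v-1` and the lines `0, …, v-1`, `v = n² + n + 1`
(incidence atom `x_(p,B)` = variable `p * v + B`; see the module docstring for the other
blocks). Satisfiable iff a projective plane of order `n` exists
(`planeCNF_satisfiable_iff_exists_projectivePlane`).
[Kiss–Szőnyi 2019, Def. 1.3, Thm. 1.8; Krajíček 2019, §1.2] [cite: KissSzonyi2019, Def. 1.3] -/
def planeCNF (n : ℕ) : CNF ℕ :=
  (projectivePlaneCNF (n ^ 2 + n + 1)).relabel PlaneVar.encode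

/-! ### Semantics: incidence relations satisfying P1–P4 -/

/-- An incidence relation `I p B` ("point `p` lies on line `B`") between `v` points and `v` lines
satisfies the axioms of an abstract projective plane [Kiss–Szőnyi 2019, Def. 1.3]: P1∃
(`line_through`), P2∃ (`point_on`), uniqueness (`eq_or_eq`, in Mathlib's
`Configuration.Nondegenerate.eq_or_eq` form), P3 (`third_point`: every line has a point outside
any `{p, p'}`, i.e. at least three points) and P4 (`third_line`). This is the relational form of
"projective plane" that `projectivePlaneCNF v` expresses (`satisfiable_projectivePlaneCNF_iff`);
it is equivalent to carrying a `Configuration.ProjectivePlane` structure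
(`IsPlaneIncidence.nonempty_projectivePlane`, `IsPlaneIncidence.of_projectivePlane`).
[Kiss–Szőnyi 2019, Def. 1.3] [cite: KissSzonyi2019, Def. 1.3] -/
structure IsPlaneIncidence (v : ℕ) (I : Fin v → Fin v → Prop) : Prop where
  /-- P1, existence: two distinct points have a common line. -/
  line_through : ∀ p p' : Fin v, p ≠ p' → ∃ B, I p B ∧ I p' B
  /-- P2, existence: two distinct lines have a common point. -/
  point_on : ∀ B B' : Fin v, B ≠ B' → ∃ p, I p B ∧ I p B'
  /-- P1/P2, uniqueness: two points on two lines are equal or the lines are. -/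
  eq_or_eq : ∀ {p p' B B' : Fin v}, I p B → I p' B → I p B' → I p' B' → p = p' ∨ B = B'
  /-- P3: every line carries a point outside any two given points. -/
  third_point : ∀ B p p' : Fin v, ∃ q, q ≠ p ∧ q ≠ p' ∧ I q B
  /-- P4: every point is on a line outside any two given lines. -/
  third_line : ∀ p B B' : Fin v, ∃ C, C ≠ B ∧ C ≠ B' ∧ I p C

/-- The canonical assignment of the plane CNF determined by an incidence relation `I`: atoms by
`I`, flags by the conjunctions, chain variables by their intended values ("some disjunct of index
`≥ j` is true"). [Krajíček 2019, §1.2 (Lemma 1.2.3), §5.1] [cite: Krajicek2019, §1.2] -/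
def planeAssignment {v : ℕ} (I : Fin v → Fin v → Prop) [DecidableRel I] : PlaneVar v → Bool
  | .inc p B => decide (I p B)
  | .flagP p p' B => decide (I p B) && decide (I p' B)
  | .flagL B B' p => decide (I p B) && decide (I p B')
  | .zLine p p' j => ((List.finRange v).drop j).any fun B => decide (I p B) && decide (I p' B)
  | .zPoint B B' j => ((List.finRange v).drop j).any fun p => decide (I p B) && decide (I p B')
  | .zThirdP B p p' j =>
    ((List.finRange v).drop j).any fun q => decide (q ≠ p ∧ q ≠ p') && decide (I q B)
  | .zThirdL p B B' j =>
    ((List.finRange v).drop j).any fun C => decide (C ≠ B ∧ C ≠ B') && decide (I p C)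

/-- **Soundness of the encoding**: the incidence relation read off from a satisfying assignment
of `projectivePlaneCNF v` satisfies P1–P4. [Krajíček 2019, §1.2, Lemma 1.2.3; Kiss–Szőnyi 2019,
Def. 1.3] [cite: Krajicek2019, §1.2] -/
theorem isPlaneIncidence_of_eval_projectivePlaneCNF {v : ℕ} {σ : PlaneVar v → Bool}
    (h : (projectivePlaneCNF v).eval σ = true) :
    IsPlaneIncidence v (fun p B => σ (.inc p B) = true) := by
  simp only [projectivePlaneCNF, CNF.eval_append_eq_true_iff] at h
  obtain ⟨⟨⟨⟨⟨⟨hfP, hfL⟩, hexP⟩, hexL⟩, huniq⟩, h3P⟩, h3L⟩ := h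
  rw [PlaneCNF.eval_flagFamily_iff] at hfP hfL
  rw [PlaneCNF.eval_uniqueFamily_iff] at huniq
  have key : ∀ p p' B B' : Fin v, p < p' → B < B' → σ (.inc p B) = true →
      σ (.inc p' B) = true → σ (.inc p B') = true → σ (.inc p' B') = true → False :=
    fun p p' B B' hp hB h₁ h₂ h₃ h₄ => huniq p p' hp B B' hB ⟨h₁, h₂, h₃, h₄⟩
  refine ⟨?_, ?_, ?_, ?_, ?_⟩
  · intro p p' hne
    rcases lt_or_gt_of_ne hne with hlt | hlt
    · obtain ⟨B, hB⟩ := PlaneCNF.exists_flag_of_eval_existsFamily hexP hlt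
      rw [hfP p p' hlt B, Bool.and_eq_true] at hB
      exact ⟨B, hB.1, hB.2⟩
    · obtain ⟨B, hB⟩ := PlaneCNF.exists_flag_of_eval_existsFamily hexP hlt
      rw [hfP p' p hlt B, Bool.and_eq_true] at hB
      exact ⟨B, hB.2, hB.1⟩
  · intro B B' hne
    rcases lt_or_gt_of_ne hne with hlt | hlt
    · obtain ⟨p, hp⟩ := PlaneCNF.exists_flag_of_eval_existsFamily hexL hlt
      rw [hfL B B' hlt p, Bool.and_eq_true] at hp
      exact ⟨p, hp.1, hp.2⟩
    · obtain ⟨p, hp⟩ := PlaneCNF.exists_flag_of_eval_existsFamily hexL hlt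
      rw [hfL B' B hlt p, Bool.and_eq_true] at hp
      exact ⟨p, hp.2, hp.1⟩
  · intro p p' B B' h₁ h₂ h₃ h₄
    by_contra hcon
    simp only [not_or] at hcon
    rcases lt_or_gt_of_ne hcon.1 with hp | hp <;> rcases lt_or_gt_of_ne hcon.2 with hB | hB
    · exact key p p' B B' hp hB h₁ h₂ h₃ h₄
    · exact key p p' B' B hp hB h₃ h₄ h₁ h₂
    · exact key p' p B B' hp hB h₂ h₁ h₄ h₃
    · exact key p' p B' B hp hB h₄ h₃ h₂ h₁
  · exact PlaneCNF.exists_third_of_eval_thirdFamily h3P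
  · intro p B B'
    exact PlaneCNF.exists_third_of_eval_thirdFamily h3L p B B'

/-- **Completeness of the encoding**: the canonical assignment of an incidence relation
satisfying P1–P4 satisfies `projectivePlaneCNF v`. [Krajíček 2019, §1.2, Lemma 1.2.3]
[cite: Krajicek2019, §1.2] -/
theorem eval_projectivePlaneCNF_planeAssignment {v : ℕ} {I : Fin v → Fin v → Prop}
    [DecidableRel I] (hI : IsPlaneIncidence v I) :
    (projectivePlaneCNF v).eval (planeAssignment I) = true := by
  simp only [projectivePlaneCNF, CNF.eval_append_eq_true_iff]
  refine ⟨⟨⟨⟨⟨⟨?_, ?_⟩, ?_⟩, ?_⟩, ?_⟩, ?_⟩, ?_⟩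
  · rw [PlaneCNF.eval_flagFamily_iff]
    intro a a' _ b
    rfl
  · rw [PlaneCNF.eval_flagFamily_iff]
    intro a a' _ b
    rfl
  · refine PlaneCNF.eval_existsFamily_of (fun p p' hlt => ?_) (fun p p' _ i hi => ?_)
    · obtain ⟨B, h₁, h₂⟩ := hI.line_through p p' (ne_of_lt hlt)
      exact ⟨B, by simp [planeAssignment, h₁, h₂]⟩
    · simp [planeAssignment, chainIdx, Nat.min_eq_left hi]
  · refine PlaneCNF.eval_existsFamily_of (fun B B' hlt => ?_) (fun B B' _ i hi => ?_)
    · obtain ⟨p, h₁, h₂⟩ := hI.point_on B B' (ne_of_lt hlt)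
      exact ⟨p, by simp [planeAssignment, h₁, h₂]⟩
    · simp [planeAssignment, chainIdx, Nat.min_eq_left hi]
  · rw [PlaneCNF.eval_uniqueFamily_iff]
    intro p p' hp B B' hB hall
    simp only [planeAssignment, decide_eq_true_eq] at hall
    rcases hI.eq_or_eq hall.1 hall.2.1 hall.2.2.1 hall.2.2.2 with h | h
    · exact absurd hp (h ▸ lt_irrefl _)
    · exact absurd hB (h ▸ lt_irrefl _)
  · refine PlaneCNF.eval_thirdFamily_of (fun B p p' => ?_) (fun B p p' i hi => ?_)
    · obtain ⟨q, h₁, h₂, h₃⟩ := hI.third_point B p p'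
      exact ⟨q, h₁, h₂, by simp [planeAssignment, h₃]⟩
    · simp [planeAssignment, chainIdx, Nat.min_eq_left hi]
  · refine PlaneCNF.eval_thirdFamily_of (fun p B B' => ?_) (fun p B B' i hi => ?_)
    · obtain ⟨C, h₁, h₂, h₃⟩ := hI.third_line p B B'
      exact ⟨C, h₁, h₂, by simp [planeAssignment, h₃]⟩
    · simp [planeAssignment, chainIdx, Nat.min_eq_left hi]

/-- **Semantics of the plane CNF over structured variables** (Krajíček's Lemma 1.2.3 for the
plane axioms): `projectivePlaneCNF v` is satisfiable iff some incidence relation between `v`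
points and `v` lines satisfies P1–P4. [Krajíček 2019, §1.2, Lemma 1.2.3; Kiss–Szőnyi 2019,
Def. 1.3] [cite: Krajicek2019, §1.2] -/
theorem satisfiable_projectivePlaneCNF_iff (v : ℕ) :
    (projectivePlaneCNF v).Satisfiable ↔ ∃ I : Fin v → Fin v → Prop, IsPlaneIncidence v I := by
  classical
  constructor
  · rintro ⟨σ, hσ⟩
    exact ⟨_, isPlaneIncidence_of_eval_projectivePlaneCNF hσ⟩
  · rintro ⟨I, hI⟩
    exact ⟨planeAssignment I, eval_projectivePlaneCNF_planeAssignment hI⟩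

/-- **Semantics of `planeCNF n`, relational form**: satisfiable iff some incidence relation
between `n² + n + 1` points and as many lines satisfies P1–P4.
[Krajíček 2019, §1.2, Lemma 1.2.3; Kiss–Szőnyi 2019, Def. 1.3] [cite: Krajicek2019, §1.2] -/
theorem planeCNF_satisfiable_iff_isPlaneIncidence (n : ℕ) :
    (planeCNF n).Satisfiable ↔
      ∃ I : Fin (n ^ 2 + n + 1) → Fin (n ^ 2 + n + 1) → Prop, IsPlaneIncidence (n ^ 2 + n + 1) I :=
  (CNF.satisfiable_relabel_iff PlaneVar.encode_injective _).trans
    (satisfiable_projectivePlaneCNF_iff _)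

/-! ### Width and size -/

/-- The structured plane CNF has width at most `4`. [folklore] -/
theorem isWidthLE_projectivePlaneCNF (v : ℕ) : (projectivePlaneCNF v).IsWidthLE 4 := by
  intro c hc
  simp only [projectivePlaneCNF, List.mem_append] at hc
  rcases hc with (((((hc | hc) | hc) | hc) | hc) | hc) | hc
  · exact (PlaneCNF.isWidthLE_flagFamily _ _ c hc).trans (by norm_num)
  · exact (PlaneCNF.isWidthLE_flagFamily _ _ c hc).trans (by norm_num)
  · exact (PlaneCNF.isWidthLE_existsFamily _ _ c hc).trans (by norm_num)
  · exact (PlaneCNF.isWidthLE_existsFamily _ _ c hc).trans (by norm_num)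
  · exact PlaneCNF.isWidthLE_uniqueFamily _ c hc
  · exact (PlaneCNF.isWidthLE_thirdFamily _ _ c hc).trans (by norm_num)
  · exact (PlaneCNF.isWidthLE_thirdFamily _ _ c hc).trans (by norm_num)

/-- **`planeCNF n` is a 4-CNF.** [folklore] -/
theorem isWidthLE_planeCNF (n : ℕ) : (planeCNF n).IsWidthLE 4 :=
  (isWidthLE_projectivePlaneCNF _).relabel _

/-- The number of clauses of the structured plane CNF: at most `3 v⁴ + 12 v³ + 4 v²` (exactly
`6 v (v choose 2) + 2 (v + 2) (v choose 2) + (v choose 2)² + 2 v³ (v + 2)`). [folklore] -/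
theorem length_projectivePlaneCNF_le (v : ℕ) :
    (projectivePlaneCNF v).length ≤ 3 * v ^ 4 + 12 * v ^ 3 + 4 * v ^ 2 := by
  have h₁ := PlaneCNF.length_flagFamily_le (v := v) PlaneVar.inc PlaneVar.flagP
  have h₂ := PlaneCNF.length_flagFamily_le (v := v) (fun B p => PlaneVar.inc p B) PlaneVar.flagL
  have h₃ := PlaneCNF.length_existsFamily_le (v := v) PlaneVar.flagP
    (fun p p' j => PlaneVar.zLine p p' (chainIdx v j))
  have h₄ := PlaneCNF.length_existsFamily_le (v := v) PlaneVar.flagL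
    (fun B B' j => PlaneVar.zPoint B B' (chainIdx v j))
  have h₅ := PlaneCNF.length_uniqueFamily_le (v := v) PlaneVar.inc
  have h₆ := PlaneCNF.length_thirdFamily (v := v) PlaneVar.inc
    (fun B p p' j => PlaneVar.zThirdP B p p' (chainIdx v j))
  have h₇ := PlaneCNF.length_thirdFamily (v := v) (fun B p => PlaneVar.inc p B)
    (fun p B B' j => PlaneVar.zThirdL p B B' (chainIdx v j))
  simp only [projectivePlaneCNF, List.length_append]
  have e4 : v ^ 4 = v * v * (v * v) := by ring
  have e3 : v ^ 3 = v * v * v := by ring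
  have e2 : v ^ 2 = v * v := by ring
  rw [e4, e3, e2]
  nlinarith [h₁, h₂, h₃, h₄, h₅, h₆, h₇, Nat.zero_le v]

/-- **Size of `planeCNF n`**: at most `3 v⁴ + 12 v³ + 4 v²` clauses, `v = n² + n + 1`, i.e.
`Θ(n⁸)`. [folklore] -/
theorem length_planeCNF_le (n : ℕ) :
    (planeCNF n).length ≤
      3 * (n ^ 2 + n + 1) ^ 4 + 12 * (n ^ 2 + n + 1) ^ 3 + 4 * (n ^ 2 + n + 1) ^ 2 := by
  rw [planeCNF, CNF.length_relabel]
  exact length_projectivePlaneCNF_le _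

/-- **Number of variables of `planeCNF n`**: every variable is below
`planeNumVars v = 2 v⁴ + 6 v³ + 3 v²`, `v = n² + n + 1`. [folklore] -/
theorem numVars_planeCNF_le (n : ℕ) : (planeCNF n).numVars ≤ planeNumVars (n ^ 2 + n + 1) := by
  refine CNF.numVars_le_of_forall_lt fun c hc l hl => ?_
  obtain ⟨c₀, -, rfl⟩ := CNF.mem_relabel_iff.1 hc
  obtain ⟨l₀, -, rfl⟩ := List.mem_map.1 hl
  exact PlaneVar.encode_lt l₀.1

/-- The closed form `planeNumVars v = 2 v⁴ + 6 v³ + 3 v²`. [folklore] -/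
theorem planeNumVars_eq (v : ℕ) : planeNumVars v = 2 * v ^ 4 + 6 * v ^ 3 + 3 * v ^ 2 := by
  simp only [planeNumVars]
  ring


/-! ### From P1–P4 to Mathlib's `Configuration.ProjectivePlane` -/

namespace IsPlaneIncidence

variable {v : ℕ} {I : Fin v → Fin v → Prop}

/-- In a structure satisfying P1–P4 no line carries all the points (Mathlib's
`Nondegenerate.exists_point`): another line has two distinct points, which would also lie on the
given one, contradicting uniqueness. [Kiss–Szőnyi 2019, §1.1 (after Def. 1.3)]
[cite: KissSzonyi2019, Def. 1.3] -/
theorem exists_not_point (h : IsPlaneIncidence v I) (l : Fin v) : ∃ p, ¬ I p l := by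
  by_contra hall
  push Not at hall
  obtain ⟨m, hml, -, -⟩ := h.third_line l l l
  obtain ⟨q₁, -, -, h₁⟩ := h.third_point m l l
  obtain ⟨q₂, h₂₁, -, h₂⟩ := h.third_point m q₁ q₁
  rcases h.eq_or_eq (hall q₂) (hall q₁) h₂ h₁ with e | e
  · exact h₂₁ e
  · exact hml e.symm

/-- Dually, no point lies on all the lines (Mathlib's `Nondegenerate.exists_line`).
[Kiss–Szőnyi 2019, §1.1 (after Def. 1.3)] [cite: KissSzonyi2019, Def. 1.3] -/
theorem exists_not_line (h : IsPlaneIncidence v I) (p : Fin v) : ∃ l, ¬ I p l := by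
  by_contra hall
  push Not at hall
  obtain ⟨q, hqp, -, -⟩ := h.third_point p p p
  obtain ⟨C₁, -, -, h₁⟩ := h.third_line q p p
  obtain ⟨C₂, h₂₁, -, h₂⟩ := h.third_line q C₁ C₁
  rcases h.eq_or_eq h₁ (hall C₁) h₂ (hall C₂) with e | e
  · exact hqp e
  · exact h₂₁ e.symm

/-- P1–P4 yield Mathlib's non-degeneracy configuration `exists_config` (three points and three
lines in the required special position), constructed synthetically from two distinct lines
`l, m` through a point `o`, points `a, b ∈ l`, `c ∈ m`, a third point `e` of the line `ac` and the
line `cb`. Needs a point to start with (`0 < v`). [Kiss–Szőnyi 2019, Lemma 1.4 (P3, P4 versus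
four points in general position)] [cite: KissSzonyi2019, Lemma 1.4] -/
theorem exists_config (h : IsPlaneIncidence v I) (hv : 0 < v) :
    ∃ p₁ p₂ p₃ l₁ l₂ l₃ : Fin v, ¬ I p₁ l₂ ∧ ¬ I p₁ l₃ ∧ ¬ I p₂ l₁ ∧ I p₂ l₂ ∧ I p₂ l₃ ∧
      ¬ I p₃ l₁ ∧ I p₃ l₂ ∧ ¬ I p₃ l₃ := by
  set l : Fin v := ⟨0, hv⟩
  obtain ⟨m, hml, -, -⟩ := h.third_line l l l
  obtain ⟨o, hol, hom⟩ := h.point_on l m (Ne.symm hml)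
  have uniq : ∀ x, I x l → I x m → x = o := fun x hxl hxm =>
    (h.eq_or_eq hxl hol hxm hom).resolve_right (Ne.symm hml)
  obtain ⟨a, hao, -, hal⟩ := h.third_point l o o
  obtain ⟨b, hbo, hba, hbl⟩ := h.third_point l o a
  obtain ⟨c, hco, -, hcm⟩ := h.third_point m o o
  have hcl : ¬ I c l := fun hcl => hco (uniq c hcl hcm)
  have ham : ¬ I a m := fun ham => hao (uniq a hal ham)
  have hbm : ¬ I b m := fun hbm => hbo (uniq b hbl hbm)
  have hac : a ≠ c := fun e => hcl (e ▸ hal)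
  obtain ⟨ac, haac, hcac⟩ := h.line_through a c hac
  obtain ⟨e, hea, hec, heac⟩ := h.third_point ac a c
  have hel : ¬ I e l := fun hel => by
    rcases h.eq_or_eq hel hal heac haac with h₁ | h₁
    · exact hea h₁
    · exact hcl (by rw [h₁]; exact hcac)
  have hem : ¬ I e m := fun hem => by
    rcases h.eq_or_eq hem hcm heac hcac with h₁ | h₁
    · exact hec h₁
    · exact ham (by rw [h₁]; exact haac)
  have hcb : c ≠ b := fun e' => hcl (by rw [e']; exact hbl)
  obtain ⟨cb, hccb, hbcb⟩ := h.line_through c b hcb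
  have hocb : ¬ I o cb := fun hocb => by
    rcases h.eq_or_eq hom hcm hocb hccb with h₁ | h₁
    · exact hco h₁.symm
    · exact hbm (by rw [h₁]; exact hbcb)
  have hacb : ¬ I a cb := fun hacb => by
    rcases h.eq_or_eq hal hbl hacb hbcb with h₁ | h₁
    · exact hba h₁.symm
    · exact hcl (by rw [h₁]; exact hccb)
  exact ⟨e, o, a, cb, l, m, hel, hem, hocb, hol, hom, hacb, hal, ham⟩

/-- **P1–P4 give a projective plane in Mathlib's sense**: an incidence relation on `v ≥ 1`
points and `v` lines satisfying P1–P4 carries a `Configuration.ProjectivePlane` structure for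
the membership `p ∈ B :↔ I p B` (the intersection point / connecting line are chosen by
`Classical.choose`). [Kiss–Szőnyi 2019, Def. 1.3, Lemma 1.4; Mathlib `Configuration.ProjectivePlane`]
[cite: KissSzonyi2019, Def. 1.3] -/
theorem nonempty_projectivePlane (h : IsPlaneIncidence v I) (hv : 0 < v) :
    Nonempty (@Configuration.ProjectivePlane (Fin v) (Fin v) ⟨fun B p => I p B⟩) := by
  classical
  letI : Membership (Fin v) (Fin v) := ⟨fun B p => I p B⟩
  obtain ⟨p₁, p₂, p₃, l₁, l₂, l₃, hc⟩ := h.exists_config hv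
  exact ⟨{
    exists_point := h.exists_not_point
    exists_line := h.exists_not_line
    eq_or_eq := fun h₁ h₂ h₃ h₄ => h.eq_or_eq h₁ h₂ h₃ h₄
    mkPoint := fun {B B'} hne => Classical.choose (h.point_on B B' hne)
    mkPoint_ax := fun {B B'} hne => Classical.choose_spec (h.point_on B B' hne)
    mkLine := fun {p p'} hne => Classical.choose (h.line_through p p' hne)
    mkLine_ax := fun {p p'} hne => Classical.choose_spec (h.line_through p p' hne)
    exists_config := ⟨p₁, p₂, p₃, l₁, l₂, l₃, hc⟩ }⟩

/-- **Conversely, every finite projective plane satisfies P1–P4** when its points and lines are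
numbered by `Fin v` (P3/P4 from Mathlib's `two_lt_pointCount` / `two_lt_lineCount`).
[Kiss–Szőnyi 2019, Def. 1.3; Mathlib `Configuration.ProjectivePlane`] [cite: KissSzonyi2019, Def. 1.3] -/
theorem of_projectivePlane {P L : Type*} [Membership P L] [Configuration.ProjectivePlane P L]
    [Finite P] [Finite L] (eP : Fin v ≃ P) (eL : Fin v ≃ L) :
    IsPlaneIncidence v (fun p B => eP p ∈ eL B) where
  line_through p p' hne := by
    obtain ⟨h₁, h₂⟩ := Configuration.HasLines.mkLine_ax (P := P) (L := L) (eP.injective.ne hne)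
    exact ⟨eL.symm (Configuration.HasLines.mkLine (eP.injective.ne hne)), by simpa using h₁,
      by simpa using h₂⟩
  point_on B B' hne := by
    obtain ⟨h₁, h₂⟩ := Configuration.HasPoints.mkPoint_ax (P := P) (L := L) (eL.injective.ne hne)
    exact ⟨eP.symm (Configuration.HasPoints.mkPoint (eL.injective.ne hne)), by simpa using h₁,
      by simpa using h₂⟩
  eq_or_eq h₁ h₂ h₃ h₄ :=
    (Configuration.Nondegenerate.eq_or_eq h₁ h₂ h₃ h₄).imp (fun e => eP.injective e)
      fun e => eL.injective e
  third_point B p p' := by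
    have h3 := Configuration.ProjectivePlane.two_lt_pointCount P (eL B)
    unfold Configuration.pointCount at h3
    haveI : Fintype {q : P // q ∈ eL B} := Fintype.ofFinite _
    rw [Nat.card_eq_fintype_card, Fintype.two_lt_card_iff] at h3
    obtain ⟨⟨a, ha⟩, ⟨b, hb⟩, ⟨c, hc⟩, hab, hac, hbc⟩ := h3
    simp only [Ne, Subtype.mk.injEq] at hab hac hbc
    by_contra hno
    push Not at hno
    have key : ∀ x : P, x ∈ eL B → eP.symm x = p ∨ eP.symm x = p' := by
      intro x hx
      by_contra hh
      push Not at hh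
      exact hno (eP.symm x) hh.1 hh.2 (by simpa using hx)
    rcases key a ha with ka | ka <;> rcases key b hb with kb | kb <;>
      rcases key c hc with kc | kc <;>
      first
      | exact hab (eP.symm.injective (ka.trans kb.symm))
      | exact hac (eP.symm.injective (ka.trans kc.symm))
      | exact hbc (eP.symm.injective (kb.trans kc.symm))
  third_line p B B' := by
    have h3 := Configuration.ProjectivePlane.two_lt_lineCount L (eP p)
    unfold Configuration.lineCount at h3
    haveI : Fintype {m : L // eP p ∈ m} := Fintype.ofFinite _
    rw [Nat.card_eq_fintype_card, Fintype.two_lt_card_iff] at h3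
    obtain ⟨⟨a, ha⟩, ⟨b, hb⟩, ⟨c, hc⟩, hab, hac, hbc⟩ := h3
    simp only [Ne, Subtype.mk.injEq] at hab hac hbc
    by_contra hno
    push Not at hno
    have key : ∀ m : L, eP p ∈ m → eL.symm m = B ∨ eL.symm m = B' := by
      intro m hm
      by_contra hh
      push Not at hh
      exact hno (eL.symm m) hh.1 hh.2 (by simpa using hm)
    rcases key a ha with ka | ka <;> rcases key b hb with kb | kb <;>
      rcases key c hc with kc | kc <;>
      first
      | exact hab (eL.symm.injective (ka.trans kb.symm))
      | exact hac (eL.symm.injective (ka.trans kc.symm))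
      | exact hbc (eL.symm.injective (kb.trans kc.symm))

end IsPlaneIncidence

/-- The order of a finite projective plane is determined by its number of points: if there are
`n² + n + 1` points the order is `n` (`card_points`: `|P| = order² + order + 1`, and
`k ↦ k² + k + 1` is injective). [Kiss–Szőnyi 2019, Thm. 1.8, Def. 1.9]
[cite: KissSzonyi2019, Thm. 1.8] -/
theorem projectivePlane_order_eq_of_card {P L : Type*} [Membership P L]
    [Configuration.ProjectivePlane P L] [Fintype P] [Fintype L] {n : ℕ}
    (h : Fintype.card P = n ^ 2 + n + 1) : Configuration.ProjectivePlane.order P L = n := by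
  have key := Configuration.ProjectivePlane.card_points P L
  rw [h] at key
  have hmono : StrictMono fun k : ℕ => k ^ 2 + k + 1 := fun a b hab => by
    have : a ^ 2 < b ^ 2 := Nat.pow_lt_pow_left hab two_ne_zero
    show a ^ 2 + a + 1 < b ^ 2 + b + 1
    omega
  exact (hmono.injective key).symm

/-- **Main semantics, `Fin` form**: `planeCNF n` is satisfiable iff `Fin (n²+n+1)` (points) and
`Fin (n²+n+1)` (lines) carry a projective-plane structure in Mathlib's sense for some
membership relation; such a plane automatically has order `n`
(`projectivePlane_order_eq_of_card`). [Kiss–Szőnyi 2019, Def. 1.3, Thm. 1.8; Krajíček 2019,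
§1.2, Lemma 1.2.3] [cite: KissSzonyi2019, Def. 1.3] -/
theorem planeCNF_satisfiable_iff (n : ℕ) :
    (planeCNF n).Satisfiable ↔ ∃ M : Membership (Fin (n ^ 2 + n + 1)) (Fin (n ^ 2 + n + 1)),
      Nonempty (@Configuration.ProjectivePlane (Fin (n ^ 2 + n + 1)) (Fin (n ^ 2 + n + 1)) M) := by
  rw [planeCNF_satisfiable_iff_isPlaneIncidence]
  constructor
  · rintro ⟨I, hI⟩
    exact ⟨⟨fun B p => I p B⟩, hI.nonempty_projectivePlane (by positivity)⟩
  · rintro ⟨M, ⟨inst⟩⟩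
    letI := M
    letI := inst
    exact ⟨fun p B => p ∈ B, IsPlaneIncidence.of_projectivePlane (Equiv.refl _) (Equiv.refl _)⟩

/-- **Every finite projective plane of order `n` makes `planeCNF n` satisfiable** (number its
points and lines and take the canonical assignment). [Kiss–Szőnyi 2019, Thm. 1.8; Krajíček 2019,
§1.2, Lemma 1.2.3] [cite: KissSzonyi2019, Thm. 1.8] -/
theorem planeCNF_satisfiable_of_projectivePlane (P L : Type*) [Membership P L]
    [Configuration.ProjectivePlane P L] [Fintype P] [Fintype L] :
    (planeCNF (Configuration.ProjectivePlane.order P L)).Satisfiable := by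
  rw [planeCNF_satisfiable_iff_isPlaneIncidence]
  have hP := Configuration.ProjectivePlane.card_points P L
  have hL := Configuration.ProjectivePlane.card_lines P L
  exact ⟨_, IsPlaneIncidence.of_projectivePlane (Fintype.equivFinOfCardEq hP).symm
    (Fintype.equivFinOfCardEq hL).symm⟩

/-- **Main semantics, abstract form**: `planeCNF n` is satisfiable iff there is a finite
projective plane of order `n` (in Mathlib's sense `Configuration.ProjectivePlane`, with points and
lines in `Type`). In particular `¬ (planeCNF n).Satisfiable` is the propositional statement
"there is no projective plane of order `n`". [Kiss–Szőnyi 2019, Def. 1.3, Thm. 1.8, Def. 1.9;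
Krajíček 2019, §1.2, Lemma 1.2.3] [cite: KissSzonyi2019, Thm. 1.8] -/
theorem planeCNF_satisfiable_iff_exists_projectivePlane (n : ℕ) :
    (planeCNF n).Satisfiable ↔ ∃ (P L : Type) (_ : Membership P L) (_ : Fintype P) (_ : Fintype L)
      (_ : Configuration.ProjectivePlane P L), Configuration.ProjectivePlane.order P L = n := by
  constructor
  · intro h
    obtain ⟨M, ⟨inst⟩⟩ := (planeCNF_satisfiable_iff n).1 h
    exact ⟨Fin (n ^ 2 + n + 1), Fin (n ^ 2 + n + 1), M, inferInstance, inferInstance, inst,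
      @projectivePlane_order_eq_of_card _ _ M inst _ _ n (Fintype.card_fin _)⟩
  · rintro ⟨P, L, M, iP, iL, inst, rfl⟩
    exact planeCNF_satisfiable_of_projectivePlane P L

/-- Projective planes have order at least `2` (Mathlib's `one_lt_order`), so a satisfiable
`planeCNF n` has `n ≥ 2`; in particular `planeCNF 0` and `planeCNF 1` are contradictions.
[Kiss–Szőnyi 2019, remark after Def. 1.9 ("the order of a plane is at least 2")]
[cite: KissSzonyi2019, Def. 1.9] -/
theorem two_le_of_planeCNF_satisfiable {n : ℕ} (h : (planeCNF n).Satisfiable) : 2 ≤ n := by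
  obtain ⟨P, L, M, iP, iL, inst, rfl⟩ := (planeCNF_satisfiable_iff_exists_projectivePlane n).1 h
  exact Configuration.ProjectivePlane.one_lt_order P L

/-- `planeCNF 0` is unsatisfiable. [Kiss–Szőnyi 2019, Def. 1.9] [cite: KissSzonyi2019, Def. 1.9] -/
theorem planeCNF_zero_not_satisfiable : ¬ (planeCNF 0).Satisfiable := fun h =>
  absurd (two_le_of_planeCNF_satisfiable h) (by norm_num)

/-- `planeCNF 1` is unsatisfiable. [Kiss–Szőnyi 2019, Def. 1.9] [cite: KissSzonyi2019, Def. 1.9] -/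
theorem planeCNF_one_not_satisfiable : ¬ (planeCNF 1).Satisfiable := fun h =>
  absurd (two_le_of_planeCNF_satisfiable h) (by norm_num)

/-- **Non-vacuity: `PG(2, q)` witnesses `planeCNF q`** for every finite field with `q` elements
(Mathlib's `Configuration.ofField` instance on `ℙ K (Fin 3 → K)`, which has `q² + q + 1` points by
`Projectivization.card_of_finrank`). E.g. `planeCNF 2`, `planeCNF 3`, `planeCNF 4`, `planeCNF 5`
are satisfiable. [Kiss–Szőnyi 2019, §1.2 (the planes `PG(2, q)`)] [cite: KissSzonyi2019, Thm. 1.8] -/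
theorem planeCNF_satisfiable_of_field (K : Type*) [Field K] [Fintype K] :
    (planeCNF (Fintype.card K)).Satisfiable := by
  classical
  letI : Fintype (Projectivization K (Fin 3 → K)) := Fintype.ofFinite _
  have hcard : Fintype.card (Projectivization K (Fin 3 → K)) =
      Fintype.card K ^ 2 + Fintype.card K + 1 := by
    have h := Projectivization.card_of_finrank K (Fin 3 → K) (n := 3) (by simp)
    rw [Nat.card_eq_fintype_card, Nat.card_eq_fintype_card] at h
    rw [h, Finset.sum_range_succ, Finset.sum_range_succ, Finset.sum_range_succ,
      Finset.sum_range_zero]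
    ring
  have horder := projectivePlane_order_eq_of_card
    (L := Projectivization K (Fin 3 → K)) hcard
  rw [← horder]
  exact planeCNF_satisfiable_of_projectivePlane _ _

/-- **Non-vacuity at every prime order**: `planeCNF p` is satisfiable for `p` prime
(`PG(2, p)` over `ZMod p`); e.g. `planeCNF 2` (the Fano plane) and `planeCNF 3`.
[Kiss–Szőnyi 2019, §1.2 (`PG(2, q)`), Example 1.5 (Fano plane)] [cite: KissSzonyi2019, Thm. 1.8] -/
theorem planeCNF_satisfiable_of_prime (p : ℕ) [Fact p.Prime] : (planeCNF p).Satisfiable := by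
  simpa [ZMod.card] using planeCNF_satisfiable_of_field (ZMod p)

end Literature.Computability.Complexity
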